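/-
Copyright (c) 2026 the pub-hodgecm-mathlib formalisation cell (harness21).  Prover seat hodgecm-mathlib-LH4-p01 (g9), F3-3 pen (dealer LH4-plan (g8) DEAL g8-#19c, WORD #69;
route (B) F3 «TOT-Λ by over-orders»), heir LEAD F0P3a-plan (g16), 2026-09-02.  FILE 1 of 2 (the level law); FILE 2 = `GluedOverOrderUnitaryGenerator`.
-/
import Literature.NumberTheory.Automorphic.QuadraticEisensteinOrderNormIndex   -- ★ (L3′) B-p04 p851869 (the index theorem FILE 2 feeds); brings (L1′) `coord_mul_eisenstein`, `isUnit_add_mul_iff_eisenstein`, ★ [T2-c] `coord_unique`, `map_k₀_mem_maximalIdeal`, ★ O1∕O2 `IsUniformizingElement`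
import HarnessLib

/-!
# The level law of the glued over-orders: a norm-one generator of `O_{N″}`, Hilbert 90 at level `b`, and the EXACT valuation of the character polynomial
# (Serre, Corps locaux I §6, V §2, X §1; Neukirch I §12; Rogawski 1990 §4.9)

Topic `NumberTheory/Automorphic`; namespace `Literature.NumberTheory.Automorphic`.  THEOREMS ONLY (no definition, no instance, no notation, no named fact, no `sorry`);
(D0) currency of ★ (L3′) `QuadraticEisensteinOrderNormIndex` = ★ F3-1 `GluedOverOrders` (two valued fields `F → E`, `ιO σO`, the Eisenstein quadratic ring `O₁ = j𝒪_E ⊕ j𝒪_E θ`,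
`θ² = j(ιO a)θ + j(ιO k)`, involution `σ₁` over `σO` fixing `θ`).  Cell `pub/hodgecm-mathlib` (D-0151), crux H413 = `stmt-HodgeConjecture-24833`; M6 road «TOT-Λ», route (B)
«by over-orders» (dealer LH4-plan (g8) WORD #69; F3-0 FIT LH7-p04 (g11); law memo `F0/P3c/LH4/LH4-p01/g9/o4/f3/F3-LAW.v1`), file F3-3 per SIG-F3-3 eaa558e6, FILE 1 of 2: the three
inputs of the deep unitary generator (FILE 2 `GluedOverOrderUnitaryGenerator`).
HONEST LABEL: HC_CM is proved only modulo the 7 printed citations (2 remaining named inputs: hLiu418 = stmt-HodgeConjecture-24832, h413 = stmt-HodgeConjecture-24833) until rung 0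
closes; commutative algebra, count-neutral (pays no organ, opens no road).

THE MATHEMATICS.  §1: for ANY `ξ ∈ 𝒪_E` and `σO`-fixed `π`, `z := 1 + j(ξπ^{N″})θ ∈ O₁^×` and `λ′ := z ∕ σ₁ z = j p′ + j q′ θ` is UNITARY (`λ′·σ₁λ′ = 1`) with `q′·ν = (ξ − σO ξ)π^{N″}`
for a unit `ν` and `p′ ≡ 1` (Hilbert 90 made explicit on the Eisenstein multiplication table; with `ξ − σO ξ` a unit, `q′` has EXACT valuation `N″`).  §2: a unit `c` with
`c·σO c ≡ 1 (ϖ^b)` is `≡` an exact norm-one `u′` (from the binder «`N(U_E^{(b)}) = U_F^{(b)}`», unramified, discharged at the place).  §3: uniformiser-power bookkeeping in `𝒪_E` and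
THE LEVEL LAW of the character polynomial `f_{N″}(x) = x² − ϖ^{N″}a·x − ϖ^{2N″}k`: at the ODD level (`c′ ∈ (ϖ^{N″+1})`, `b = 2N″+1`) and at the EVEN level (`v(c′) = v(ϖ)^M`,
`b = 2M ≤ 2N″`) the character congruence `f_{N″}(c′) ≡ 0 (ϖ^b)` holds and `v(f_{N″}(x)) = v(ϖ)^b` EXACTLY for every `x ≡ c′ (ϖ^b)` — the line's law «`n` even `≤ 2N` or `n = 2N+1`»
one level down.  No `|2| = 1`, no parity binder (T14-66 KILL clause honoured).
[cite: SerreLocalFields1979, Ch. I §6 Prop. 17–18; Ch. V §2 Prop. 3; Ch. X §1] [cite: Neukirch1999, Ch. I §12] [cite: Rogawski1990, §4.9 Lemma 4.9.3 p. 56]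

## References
* [SerreLocalFields1979] J.-P. Serre, *Local Fields*, GTM 67 (1979): Ch. I §6 Prop. 17–18 (Eisenstein equations); Ch. V §2 Prop. 3 + Cor. (norms of the unit filtration at an
  unramified extension); Ch. X §1 (Hilbert 90).
* [Neukirch1999] J. Neukirch, *Algebraic Number Theory*, Grundlehren 322 (1999): Ch. I §12 (orders, conductors).
* [Rogawski1990] J. D. Rogawski, *Automorphic Representations of Unitary Groups in Three Variables*, Ann. of Math. Stud. 123 (1990): §4.9 Lemma 4.9.3 p. 56, Prop. 4.9.1 (b) p. 55.
-/

set_option autoImplicit false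

noncomputable section

open scoped ValuativeRel
open Polynomial ValuativeRel

namespace Literature.NumberTheory.Automorphic

variable {F E : Type*} [Field F] [ValuativeRel F] [Field E] [ValuativeRel E] {O₁ : Type*} [CommRing O₁]
  (ιO : 𝒪[F] →+* 𝒪[E]) (σO : 𝒪[E] →+* 𝒪[E]) (j : 𝒪[E] →+* O₁) (σ₁ : O₁ →+* O₁) (θ : O₁) {aF k₀F : 𝒪[F]}

/-! ## §1 A norm-one generator of `O_{N″}` with θ-coordinate of exact valuation `N″` -/

/-- **`λ′ := z ∕ σ₁z`, `z = 1 + j(ξπ^{N″})θ`, IS UNITARY WITH θ-COORDINATE `q′`, `q′·ν = (ξ − σO ξ)·π^{N″}` (`ν` a unit), AND `p′ ≡ 1`.**  Here `π ∈ 𝒪_E` is any `σO`-fixed element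
(a uniformiser from `F` in the applications) and `ξ − σO ξ` a unit (the unramified unit different).  Pure algebra on the Eisenstein multiplication table.
[cite: SerreLocalFields1979, Ch. I §6 Prop. 17–18; Ch. X §1] [cite: Rogawski1990, §4.9 Lemma 4.9.3 p. 56] -/
theorem exists_normOne_coord (hσσ : ∀ x, σO (σO x) = x) (hιu : ∀ y, IsUnit (ιO y) → IsUnit y) (hσ₁j : ∀ x, σ₁ (j x) = j (σO x)) (hσ₁θ : σ₁ θ = θ)
    (hθ : θ ^ 2 = j (ιO aF) * θ + j (ιO k₀F)) (haF : aF ∈ IsLocalRing.maximalIdeal 𝒪[F]) (hk₀ : k₀F ∈ IsLocalRing.maximalIdeal 𝒪[F])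
    (hcoord : ∀ z : O₁, ∃! bc : 𝒪[E] × 𝒪[E], z = j bc.1 + j bc.2 * θ) {π : 𝒪[E]} (hσπ : σO π = π) (ξ : 𝒪[E]) (N'' : ℕ) :
    ∃ p' q' ν : 𝒪[E], IsUnit ν ∧ p' - 1 ∈ IsLocalRing.maximalIdeal 𝒪[E] ∧ q' * ν = (ξ - σO ξ) * π ^ N'' ∧
      (j p' + j q' * θ) * σ₁ (j p' + j q' * θ) = 1 := by
  have ha : ιO aF ∈ IsLocalRing.maximalIdeal 𝒪[E] := map_k₀_mem_maximalIdeal ιO hιu haF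
  have hk : ιO k₀F ∈ IsLocalRing.maximalIdeal 𝒪[E] := map_k₀_mem_maximalIdeal ιO hιu hk₀
  set c : 𝒪[E] := σO ξ * π ^ N'' with hc
  set z : O₁ := j 1 + j (ξ * π ^ N'') * θ with hz
  set w : O₁ := j 1 + j c * θ with hw
  have hzw : σ₁ z = w := by
    rw [hz, hw, map_add, map_mul, hσ₁j, hσ₁j, hσ₁θ, map_one, map_mul, map_pow, hσπ]
  have hwz : σ₁ w = z := by
    rw [hw, hz, hc, map_add, map_mul, hσ₁j, hσ₁j, hσ₁θ, map_one, map_mul, map_pow, hσπ, hσσ]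
  have hwu : IsUnit w := (isUnit_add_mul_iff_eisenstein j θ hθ ha hk hcoord 1 c).2 isUnit_one
  have hzu : IsUnit z := (isUnit_add_mul_iff_eisenstein j θ hθ ha hk hcoord 1 _).2 isUnit_one
  obtain ⟨wU, hwU⟩ := hwu
  obtain ⟨zU, hzU⟩ := hzu
  obtain ⟨⟨p', q'⟩, hpq, -⟩ := hcoord (z * ↑wU⁻¹)
  set ν : 𝒪[E] := 1 + c * ιO aF - c * c * ιO k₀F with hν
  have hνu : IsUnit ν := by
    by_contra hn
    have hm : ν ∈ IsLocalRing.maximalIdeal 𝒪[E] := (IsLocalRing.mem_maximalIdeal _).2 hn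
    have h1 : (1 : 𝒪[E]) ∈ IsLocalRing.maximalIdeal 𝒪[E] := by
      have : (1 : 𝒪[E]) = ν - c * ιO aF + c * c * ιO k₀F := by rw [hν]; ring
      rw [this]
      exact Ideal.add_mem _ (Ideal.sub_mem _ hm (Ideal.mul_mem_left _ _ ha)) (Ideal.mul_mem_left _ _ hk)
    exact (IsLocalRing.maximalIdeal.isMaximal 𝒪[E]).ne_top (Ideal.eq_top_of_isUnit_mem _ h1 isUnit_one)
  -- `(jp′ + jq′θ)·w = z`, read on coordinates: `p′ + q′ck = 1`, `p′c + q′ + q′ca = ξπ^{N″}`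
  have hLw : (j p' + j q' * θ) * w = z := by
    have : (j p' + j q' * θ) = z * ↑wU⁻¹ := hpq.symm
    rw [this, mul_assoc, ← hwU, Units.inv_mul, mul_one]
  have hcoef := hLw
  rw [hw, hz, coord_mul_eisenstein j θ hθ p' q' 1 c] at hcoef
  obtain ⟨h1, h2⟩ := coord_unique j θ hcoord hcoef
  have e2 : q' * ν = (ξ - σO ξ) * π ^ N'' := by
    rw [hν, hc]
    linear_combination h2 - (σO ξ * π ^ N'') * h1
  refine ⟨p', q', ν, hνu, ?_, e2, ?_⟩
  · have e1 : p' - 1 = -(q' * c * ιO k₀F) := by linear_combination h1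
    rw [e1]
    exact (Ideal.neg_mem_iff _).2 (Ideal.mul_mem_left _ _ hk)
  · -- the norm: `(L·σ₁L)·(w·z) = (L·w)·(σ₁L·z) = z·w`, and `w·z` is a unit
    have hσL : σ₁ (j p' + j q' * θ) * z = w := by
      have := congrArg σ₁ hLw
      rwa [map_mul, hzw, hwz] at this
    have hprod : ((j p' + j q' * θ) * σ₁ (j p' + j q' * θ)) * (w * z) = 1 * (w * z) := by
      calc ((j p' + j q' * θ) * σ₁ (j p' + j q' * θ)) * (w * z) = ((j p' + j q' * θ) * w) * (σ₁ (j p' + j q' * θ) * z) := by ring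
        _ = z * w := by rw [hLw, hσL]
        _ = 1 * (w * z) := by ring
    have hwz_u : IsUnit (w * z) := (hwU ▸ wU.isUnit).mul (hzU ▸ zU.isUnit)
    exact hwz_u.mul_left_injective hprod

/-! ## §2 Hilbert 90 at level `b`: a norm-one residue lifts to an exact norm-one element -/

/-- **NORM-ONE LIFT AT LEVEL `b`**: if `c` is a unit with `c·σO c ≡ 1 (mod ϖ^b)` then `c ≡ u′ (mod ϖ^b)` for some `u′` with `u′·σO u′ = 1` — from the level-`b` norm surjectivity
`hnormEb` («every `σO`-fixed `r ≡ 1 (ϖ^b)` is `w·σO w` with `w ≡ 1 (ϖ^b)`», the unramified `N(U_E^{(b)}) = U_F^{(b)}`), taken as a binder and discharged at the place.  2-free.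
[cite: SerreLocalFields1979, Ch. V §2 Prop. 3 and Cor.; Ch. X §1] -/
theorem exists_normOne_sub_mem_span (hσσ : ∀ x, σO (σO x) = x) {π : 𝒪[E]} {b : ℕ}
    (hnormEb : ∀ r : 𝒪[E], σO r = r → r - 1 ∈ Ideal.span ({π ^ b} : Set 𝒪[E]) →
      ∃ w : 𝒪[E], w - 1 ∈ Ideal.span ({π ^ b} : Set 𝒪[E]) ∧ w * σO w = r)
    {c : 𝒪[E]} (hcu : IsUnit c) (hc : c * σO c - 1 ∈ Ideal.span ({π ^ b} : Set 𝒪[E])) :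
    ∃ u' : 𝒪[E], u' * σO u' = 1 ∧ u' - c ∈ Ideal.span ({π ^ b} : Set 𝒪[E]) := by
  have hfix : σO (c * σO c) = c * σO c := by rw [map_mul, hσσ, mul_comm]
  obtain ⟨w, hw1, hw⟩ := hnormEb (c * σO c) hfix hc
  have hru : IsUnit (c * σO c) := hcu.mul (hcu.map σO)
  have hwu : IsUnit w := isUnit_of_mul_isUnit_left (hw ▸ hru)
  obtain ⟨wU, rfl⟩ := hwu
  refine ⟨c * ↑wU⁻¹, ?_, ?_⟩
  · -- `(c w⁻¹)·σ(c w⁻¹) = (cσc) ∕ (wσw) = 1`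
    have hσinv : σO (↑wU⁻¹ : 𝒪[E]) * σO (↑wU : 𝒪[E]) = 1 := by rw [← map_mul, Units.inv_mul, map_one]
    calc c * ↑wU⁻¹ * σO (c * ↑wU⁻¹) = (c * σO c) * (↑wU⁻¹ * σO (↑wU⁻¹ : 𝒪[E])) := by rw [map_mul]; ring
      _ = ((wU : 𝒪[E]) * σO ↑wU) * (↑wU⁻¹ * σO (↑wU⁻¹ : 𝒪[E])) := by rw [hw]
      _ = ((wU : 𝒪[E]) * ↑wU⁻¹) * (σO (↑wU⁻¹ : 𝒪[E]) * σO (↑wU : 𝒪[E])) := by ring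
      _ = 1 := by rw [Units.mul_inv, hσinv, one_mul]
  · -- `c w⁻¹ − c = −c w⁻¹ (w − 1)`
    have : c * ↑wU⁻¹ - c = -(c * ↑wU⁻¹) * ((wU : 𝒪[E]) - 1) := by
      have h1 : (↑wU⁻¹ : 𝒪[E]) * (wU : 𝒪[E]) = 1 := Units.inv_mul _
      linear_combination c * h1
    rw [this]
    exact Ideal.mul_mem_left _ _ hw1

/-! ## §3 Valuation bookkeeping in `𝒪_E` (uniformiser powers) -/

/-- `x ∈ (ϖ^m) ↔ v(x) ≤ v(ϖ)^m` in the valuation ring. [cite: SerreLocalFields1979, Ch. I §6] -/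
theorem mem_span_uniformizer_pow_iff_valuation_le {ϖ : E} (hϖ : IsUniformizingElement ϖ) (x : 𝒪[E]) (m : ℕ) :
    x ∈ Ideal.span ({(⟨ϖ, hϖ.mem⟩ : 𝒪[E]) ^ m} : Set 𝒪[E]) ↔ valuation E (x : E) ≤ valuation E ϖ ^ m := by
  have hv0 : valuation E ϖ ≠ 0 := (Valuation.ne_zero_iff _).2 hϖ.ne_zero
  constructor
  · intro h
    obtain ⟨r, hr⟩ := Ideal.mem_span_singleton'.1 h
    have : (x : E) = (r : E) * ϖ ^ m := by
      have := congrArg Subtype.val hr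
      simpa using this.symm
    rw [this, map_mul, map_pow]
    exact mul_le_of_le_one_left' ((Valuation.mem_integer_iff _ _).1 r.2)
  · intro h
    have hmem : (x : E) / ϖ ^ m ∈ 𝒪[E] := by
      rw [Valuation.mem_integer_iff, map_div₀, map_pow]
      exact div_le_one_of_le₀ h zero_le
    refine Ideal.mem_span_singleton'.2 ⟨⟨(x : E) / ϖ ^ m, hmem⟩, Subtype.ext ?_⟩
    simp only [Subring.coe_mul, SubmonoidClass.coe_pow]
    rw [div_mul_cancel₀ _ (pow_ne_zero _ hϖ.ne_zero)]

/-- An element of exact valuation `v(ϖ)^m` lies in `(ϖ^m)`. [cite: SerreLocalFields1979, Ch. I §6] -/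
theorem mem_span_uniformizer_pow_of_valuation_eq {ϖ : E} (hϖ : IsUniformizingElement ϖ) {x : 𝒪[E]} {m : ℕ}
    (hx : valuation E (x : E) = valuation E ϖ ^ m) : x ∈ Ideal.span ({(⟨ϖ, hϖ.mem⟩ : 𝒪[E]) ^ m} : Set 𝒪[E]) :=
  (mem_span_uniformizer_pow_iff_valuation_le hϖ x m).2 hx.le

/-- Units have valuation `1`. [cite: SerreLocalFields1979, Ch. I §6] -/
theorem valuation_coe_eq_one_of_isUnit {x : 𝒪[E]} (hx : IsUnit x) : valuation E (x : E) = 1 :=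
  (Valuation.integer.integers (valuation E)).isUnit_iff_valuation_eq_one.1 hx

/-- `(ϖ^b) ⊆ 𝔪` for `b ≥ 1`. [cite: SerreLocalFields1979, Ch. I §6] -/
theorem span_uniformizer_pow_le_maximalIdeal {ϖ : E} (hϖ : IsUniformizingElement ϖ) {b : ℕ} (hb : 1 ≤ b) :
    Ideal.span ({(⟨ϖ, hϖ.mem⟩ : 𝒪[E]) ^ b} : Set 𝒪[E]) ≤ IsLocalRing.maximalIdeal 𝒪[E] := by
  rw [hϖ.span_eq, Ideal.span_singleton_le_span_singleton]
  exact dvd_pow_self _ (by omega)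

/-- EXACT LEVEL FROM THE `F`-SIDE: `y ∈ (ϖ_F^M) ∖ (ϖ_F^{M+1})` ⇒ `v_E(ιO y) = v(ϖ)^M` (`ιO ϖ_F = ϖ`, ring maps send units to units). [cite: SerreLocalFields1979, Ch. I §6] -/
theorem valuation_map_eq_of_mem_span_of_not_mem {ϖF : F} {ϖ : E} (hϖF : IsUniformizingElement ϖF) (hϖ : IsUniformizingElement ϖ)
    (hιϖ : ιO ⟨ϖF, hϖF.mem⟩ = ⟨ϖ, hϖ.mem⟩) {y : 𝒪[F]} {M : ℕ}
    (hyM : y ∈ Ideal.span ({(⟨ϖF, hϖF.mem⟩ : 𝒪[F]) ^ M} : Set 𝒪[F])) (hyM1 : y ∉ Ideal.span ({(⟨ϖF, hϖF.mem⟩ : 𝒪[F]) ^ (M + 1)} : Set 𝒪[F])) :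
    valuation E ((ιO y : 𝒪[E]) : E) = valuation E ϖ ^ M := by
  obtain ⟨y₀, hy₀⟩ := Ideal.mem_span_singleton'.1 hyM
  have hy₀u : IsUnit y₀ := by
    by_contra hnu
    have hm : y₀ ∈ IsLocalRing.maximalIdeal 𝒪[F] := (IsLocalRing.mem_maximalIdeal _).2 hnu
    rw [hϖF.span_eq] at hm
    obtain ⟨y₁, hy₁⟩ := Ideal.mem_span_singleton'.1 hm
    apply hyM1
    refine Ideal.mem_span_singleton'.2 ⟨y₁, ?_⟩
    rw [← hy₀, ← hy₁, pow_succ]; ring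
  have himg : ιO y = ιO y₀ * (⟨ϖ, hϖ.mem⟩ : 𝒪[E]) ^ M := by rw [← hy₀, map_mul, map_pow, hιϖ]
  rw [himg, Subring.coe_mul, SubmonoidClass.coe_pow, map_mul, map_pow, valuation_coe_eq_one_of_isUnit (hy₀u.map ιO), one_mul]

/-- `y ∈ (ϖ_F^m)` ⇒ `ιO y ∈ (ϖ^m)`. [cite: SerreLocalFields1979, Ch. I §6] -/
theorem map_mem_span_pow_of_mem_span_pow {ϖF : F} {ϖ : E} (hϖF : IsUniformizingElement ϖF) (hϖ : IsUniformizingElement ϖ)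
    (hιϖ : ιO ⟨ϖF, hϖF.mem⟩ = ⟨ϖ, hϖ.mem⟩) {y : 𝒪[F]} {m : ℕ}
    (hy : y ∈ Ideal.span ({(⟨ϖF, hϖF.mem⟩ : 𝒪[F]) ^ m} : Set 𝒪[F])) :
    ιO y ∈ Ideal.span ({(⟨ϖ, hϖ.mem⟩ : 𝒪[E]) ^ m} : Set 𝒪[E]) := by
  obtain ⟨y₀, hy₀⟩ := Ideal.mem_span_singleton'.1 hy
  refine Ideal.mem_span_singleton'.2 ⟨ιO y₀, ?_⟩
  rw [← hy₀, map_mul, map_pow, hιϖ]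


/-- `x ∈ 𝔪 ↔ v(x) < 1`. [cite: SerreLocalFields1979, Ch. I §6] -/
theorem valuation_coe_lt_one_of_mem_maximalIdeal {x : 𝒪[E]} (hx : x ∈ IsLocalRing.maximalIdeal 𝒪[E]) : valuation E (x : E) < 1 := by
  have h1 : valuation E (x : E) ≤ 1 := (Valuation.mem_integer_iff _ _).1 x.2
  refine lt_of_le_of_ne h1 fun h => ?_
  exact (IsLocalRing.mem_maximalIdeal _ |>.1 hx) ((Valuation.integer.integers (valuation E)).isUnit_iff_valuation_eq_one.2 h)

/-- **ODD LEVEL `b = 2N″+1`** (`c′ ∈ (ϖ^{N″+1})`): the character congruence `c′² ≡ ϖ^{N″}a·c′ + ϖ^{2N″}k (mod ϖ^b)` holds, and EVERY `x ≡ c′ (mod ϖ^b)` has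
`v(x² − ϖ^{N″}a·x − ϖ^{2N″}k) = v(ϖ)^b` EXACTLY (the constant term `ϖ^{2N″}k`, `k` a uniformiser class, dominates).  [cite: SerreLocalFields1979, Ch. I §6 Prop. 17–18] [cite: Neukirch1999, Ch. I §12] -/
theorem char_and_valuation_eq_of_odd_level {ϖ : E} (hϖ : IsUniformizingElement ϖ) {a k c' : 𝒪[E]} (ha : a ∈ IsLocalRing.maximalIdeal 𝒪[E])
    (hk₁ : valuation E (k : E) = valuation E ϖ) {N'' : ℕ} (hc' : c' ∈ Ideal.span ({(⟨ϖ, hϖ.mem⟩ : 𝒪[E]) ^ (N'' + 1)} : Set 𝒪[E])) :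
    c' * c' - ((⟨ϖ, hϖ.mem⟩ : 𝒪[E]) ^ N'' * a * c' + (⟨ϖ, hϖ.mem⟩ : 𝒪[E]) ^ (2 * N'') * k) ∈ Ideal.span ({(⟨ϖ, hϖ.mem⟩ : 𝒪[E]) ^ (2 * N'' + 1)} : Set 𝒪[E]) ∧
      ∀ x : 𝒪[E], x - c' ∈ Ideal.span ({(⟨ϖ, hϖ.mem⟩ : 𝒪[E]) ^ (2 * N'' + 1)} : Set 𝒪[E]) →
        valuation E ((x * x - (⟨ϖ, hϖ.mem⟩ : 𝒪[E]) ^ N'' * a * x - (⟨ϖ, hϖ.mem⟩ : 𝒪[E]) ^ (2 * N'') * k : 𝒪[E]) : E) = valuation E ϖ ^ (2 * N'' + 1) := by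
  set π : 𝒪[E] := ⟨ϖ, hϖ.mem⟩ with hπ
  have hπv : valuation E ((π : 𝒪[E]) : E) = valuation E ϖ := rfl
  have hv0 : valuation E ϖ ≠ 0 := (Valuation.ne_zero_iff _).2 hϖ.ne_zero
  have hv1 : valuation E ϖ < 1 := hϖ.valuation_lt_one
  have hvle : valuation E ϖ ≤ 1 := hv1.le
  have hva : valuation E (a : E) < 1 := valuation_coe_lt_one_of_mem_maximalIdeal ha
  have hle : ∀ {m n : ℕ}, n ≤ m → Ideal.span ({π ^ m} : Set 𝒪[E]) ≤ Ideal.span {π ^ n} := fun {m n} h =>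
    Ideal.span_singleton_le_span_singleton.2 (pow_dvd_pow π h)
  -- the constant term generates `(ϖ^{2N″+1})` exactly
  have hkv : valuation E ((π ^ (2 * N'') * k : 𝒪[E]) : E) = valuation E ϖ ^ (2 * N'' + 1) := by
    rw [Subring.coe_mul, SubmonoidClass.coe_pow, map_mul, map_pow, hπv, hk₁, pow_succ]
  refine ⟨?_, fun x hx => ?_⟩
  · -- Char: all three terms lie in `(ϖ^{2N″+1})`
    have h1 : c' * c' ∈ Ideal.span ({π ^ (2 * N'' + 1)} : Set 𝒪[E]) := by
      refine hle (by omega : 2 * N'' + 1 ≤ (N'' + 1) + (N'' + 1)) ?_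
      rw [pow_add]; exact Ideal.mul_mem_mul hc' hc' |> fun h => by
        rw [Ideal.span_singleton_mul_span_singleton] at h; exact h
    have h2 : π ^ N'' * a * c' ∈ Ideal.span ({π ^ (2 * N'' + 1)} : Set 𝒪[E]) := by
      have : π ^ N'' * c' ∈ Ideal.span ({π ^ (2 * N'' + 1)} : Set 𝒪[E]) := by
        have hm := Ideal.mul_mem_mul (Ideal.mem_span_singleton_self (π ^ N'')) hc'
        rw [Ideal.span_singleton_mul_span_singleton, ← pow_add, show N'' + (N'' + 1) = 2 * N'' + 1 by ring] at hm
        exact hm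
      have e : π ^ N'' * a * c' = a * (π ^ N'' * c') := by ring
      rw [e]; exact Ideal.mul_mem_left _ _ this
    have h3 : π ^ (2 * N'') * k ∈ Ideal.span ({π ^ (2 * N'' + 1)} : Set 𝒪[E]) :=
      mem_span_uniformizer_pow_of_valuation_eq hϖ hkv
    exact Ideal.sub_mem _ h1 (Ideal.add_mem _ h2 h3)
  · -- valuation: `x ∈ (ϖ^{N″+1})`, the first two terms are in `(ϖ^{2N″+2})`, the constant term has exact valuation `v(ϖ)^{2N″+1}`
    have hxm : x ∈ Ideal.span ({π ^ (N'' + 1)} : Set 𝒪[E]) := by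
      have : x = (x - c') + c' := by ring
      rw [this]; exact Ideal.add_mem _ (hle (by omega) hx) hc'
    have hxv : valuation E (x : E) ≤ valuation E ϖ ^ (N'' + 1) := (mem_span_uniformizer_pow_iff_valuation_le hϖ x _).1 hxm
    have hpos : ∀ m : ℕ, 0 < valuation E ϖ ^ m := fun m => pow_pos (zero_lt_iff.2 hv0) m
    have hlt : valuation E ϖ ^ (2 * N'' + 2) < valuation E ϖ ^ (2 * N'' + 1) :=
      pow_lt_pow_right_of_lt_one₀ (zero_lt_iff.2 hv0) hv1 (by omega)
    have hA : valuation E ((x : E) * x) < valuation E ϖ ^ (2 * N'' + 1) := by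
      rw [map_mul]
      calc valuation E (x : E) * valuation E (x : E) ≤ valuation E ϖ ^ (N'' + 1) * valuation E ϖ ^ (N'' + 1) := mul_le_mul' hxv hxv
        _ = valuation E ϖ ^ (2 * N'' + 2) := by rw [← pow_add]; ring_nf
        _ < valuation E ϖ ^ (2 * N'' + 1) := hlt
    have hB : valuation E ((ϖ : E) ^ N'' * a * x) < valuation E ϖ ^ (2 * N'' + 1) := by
      rw [map_mul, map_mul, map_pow]
      calc valuation E ϖ ^ N'' * valuation E (a : E) * valuation E (x : E)
          ≤ valuation E ϖ ^ N'' * valuation E (a : E) * valuation E ϖ ^ (N'' + 1) := mul_le_mul' le_rfl hxv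
        _ = valuation E (a : E) * valuation E ϖ ^ (2 * N'' + 1) := by
          rw [mul_comm (valuation E ϖ ^ N'') (valuation E (a : E)), mul_assoc, ← pow_add, show N'' + (N'' + 1) = 2 * N'' + 1 by ring]
        _ < valuation E ϖ ^ (2 * N'' + 1) := mul_lt_of_lt_one_left (hpos _) hva
    have hAB : valuation E ((x : E) * x - (ϖ : E) ^ N'' * a * x) < valuation E ϖ ^ (2 * N'' + 1) :=
      lt_of_le_of_lt (Valuation.map_sub _ _ _) (max_lt hA hB)
    have hkv' : valuation E ((ϖ : E) ^ (2 * N'') * k) = valuation E ϖ ^ (2 * N'' + 1) := by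
      rw [map_mul, map_pow, hk₁, pow_succ]
    push_cast
    rw [Valuation.map_sub_eq_of_lt_right _ (by rw [hkv']; exact hAB), hkv']


/-- **EVEN LEVEL `b = 2M`, `1 ≤ M ≤ N″`** (`v(c′) = v(ϖ)^M` exactly): the character congruence holds mod `ϖ^{2M}`, and EVERY `x ≡ c′ (mod ϖ^{2M})` has
`v(x² − ϖ^{N″}a·x − ϖ^{2N″}k) = v(ϖ)^{2M}` EXACTLY (the square `x²` dominates).  [cite: SerreLocalFields1979, Ch. I §6 Prop. 17–18] [cite: Neukirch1999, Ch. I §12] -/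
theorem char_and_valuation_eq_of_even_level {ϖ : E} (hϖ : IsUniformizingElement ϖ) {a k c' : 𝒪[E]} (ha : a ∈ IsLocalRing.maximalIdeal 𝒪[E])
    (hk : k ∈ IsLocalRing.maximalIdeal 𝒪[E]) {N'' M : ℕ} (hM1 : 1 ≤ M) (hMN : M ≤ N'') (hc'v : valuation E (c' : E) = valuation E ϖ ^ M) :
    c' * c' - ((⟨ϖ, hϖ.mem⟩ : 𝒪[E]) ^ N'' * a * c' + (⟨ϖ, hϖ.mem⟩ : 𝒪[E]) ^ (2 * N'') * k) ∈ Ideal.span ({(⟨ϖ, hϖ.mem⟩ : 𝒪[E]) ^ (2 * M)} : Set 𝒪[E]) ∧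
      ∀ x : 𝒪[E], x - c' ∈ Ideal.span ({(⟨ϖ, hϖ.mem⟩ : 𝒪[E]) ^ (2 * M)} : Set 𝒪[E]) →
        valuation E ((x * x - (⟨ϖ, hϖ.mem⟩ : 𝒪[E]) ^ N'' * a * x - (⟨ϖ, hϖ.mem⟩ : 𝒪[E]) ^ (2 * N'') * k : 𝒪[E]) : E) = valuation E ϖ ^ (2 * M) := by
  set π : 𝒪[E] := ⟨ϖ, hϖ.mem⟩ with hπ
  have hv0 : valuation E ϖ ≠ 0 := (Valuation.ne_zero_iff _).2 hϖ.ne_zero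
  have hv1 : valuation E ϖ < 1 := hϖ.valuation_lt_one
  have hva : valuation E (a : E) < 1 := valuation_coe_lt_one_of_mem_maximalIdeal ha
  have hvk : valuation E (k : E) < 1 := valuation_coe_lt_one_of_mem_maximalIdeal hk
  have hpos : ∀ m : ℕ, 0 < valuation E ϖ ^ m := fun m => pow_pos (zero_lt_iff.2 hv0) m
  have hanti : ∀ {m n : ℕ}, m ≤ n → valuation E ϖ ^ n ≤ valuation E ϖ ^ m := fun {m n} h => pow_le_pow_right_of_le_one' hv1.le h
  -- the three valuations, for ANY `x` with `v(x) = v(ϖ)^M`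
  have hterms : ∀ x : 𝒪[E], valuation E (x : E) = valuation E ϖ ^ M →
      valuation E ((x : E) * x) = valuation E ϖ ^ (2 * M) ∧
      valuation E ((ϖ : E) ^ N'' * a * x) < valuation E ϖ ^ (2 * M) ∧
      valuation E ((ϖ : E) ^ (2 * N'') * k) < valuation E ϖ ^ (2 * M) := by
    intro x hxv
    refine ⟨by rw [map_mul, hxv, ← pow_add, two_mul], ?_, ?_⟩
    · rw [map_mul, map_mul, map_pow, hxv]
      calc valuation E ϖ ^ N'' * valuation E (a : E) * valuation E ϖ ^ M
          = valuation E (a : E) * valuation E ϖ ^ (N'' + M) := by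
            rw [mul_comm (valuation E ϖ ^ N'') (valuation E (a : E)), mul_assoc, ← pow_add]
        _ < valuation E ϖ ^ (N'' + M) := mul_lt_of_lt_one_left (hpos _) hva
        _ ≤ valuation E ϖ ^ (2 * M) := hanti (by omega)
    · rw [map_mul, map_pow]
      calc valuation E ϖ ^ (2 * N'') * valuation E (k : E) = valuation E (k : E) * valuation E ϖ ^ (2 * N'') := mul_comm _ _
        _ < valuation E ϖ ^ (2 * N'') := mul_lt_of_lt_one_left (hpos _) hvk
        _ ≤ valuation E ϖ ^ (2 * M) := hanti (by omega)
  refine ⟨?_, fun x hx => ?_⟩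
  · -- Char: the three terms lie in `(ϖ^{2M})`
    obtain ⟨h1, h2, h3⟩ := hterms c' hc'v
    have m1 : c' * c' ∈ Ideal.span ({π ^ (2 * M)} : Set 𝒪[E]) :=
      (mem_span_uniformizer_pow_iff_valuation_le hϖ _ _).2 (by push_cast; exact h1.le)
    have m2 : π ^ N'' * a * c' ∈ Ideal.span ({π ^ (2 * M)} : Set 𝒪[E]) :=
      (mem_span_uniformizer_pow_iff_valuation_le hϖ _ _).2 (by push_cast; exact h2.le)
    have m3 : π ^ (2 * N'') * k ∈ Ideal.span ({π ^ (2 * M)} : Set 𝒪[E]) :=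
      (mem_span_uniformizer_pow_iff_valuation_le hϖ _ _).2 (by push_cast; exact h3.le)
    exact Ideal.sub_mem _ m1 (Ideal.add_mem _ m2 m3)
  · -- valuation: `v(x) = v(c′)` since `v(x − c′) ≤ v(ϖ)^{2M} < v(ϖ)^M`
    have hxc : valuation E ((x - c' : 𝒪[E]) : E) < valuation E (c' : E) := by
      rw [hc'v]
      calc valuation E ((x - c' : 𝒪[E]) : E) ≤ valuation E ϖ ^ (2 * M) := (mem_span_uniformizer_pow_iff_valuation_le hϖ _ _).1 hx
        _ < valuation E ϖ ^ M := pow_lt_pow_right_of_lt_one₀ (zero_lt_iff.2 hv0) hv1 (by omega)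
    have hxv : valuation E (x : E) = valuation E ϖ ^ M := by
      have : (x : E) = (c' : E) + ((x - c' : 𝒪[E]) : E) := by push_cast; ring
      rw [this, Valuation.map_add_eq_of_lt_left _ hxc, hc'v]
    obtain ⟨h1, h2, h3⟩ := hterms x hxv
    push_cast
    rw [Valuation.map_sub_eq_of_lt_left _ (by rw [Valuation.map_sub_eq_of_lt_left _ (by rw [h1]; exact h2)]; rw [h1]; exact h3),
      Valuation.map_sub_eq_of_lt_left _ (by rw [h1]; exact h2), h1]


/-- `x ≡ 1 (mod 𝔪)` is a unit. [cite: SerreLocalFields1979, Ch. I §6] -/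
theorem isUnit_of_sub_one_mem_maximalIdeal {x : 𝒪[E]} (hx : x - 1 ∈ IsLocalRing.maximalIdeal 𝒪[E]) : IsUnit x := by
  by_contra h
  have hm : x ∈ IsLocalRing.maximalIdeal 𝒪[E] := (IsLocalRing.mem_maximalIdeal _).2 h
  have : (1 : 𝒪[E]) ∈ IsLocalRing.maximalIdeal 𝒪[E] := by simpa using Ideal.sub_mem _ hm hx
  exact (IsLocalRing.maximalIdeal.isMaximal 𝒪[E]).ne_top (Ideal.eq_top_of_isUnit_mem _ this isUnit_one)

end Literature.NumberTheory.Automorphic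

end
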